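import Summits.PneNP.PneNP.Theorems.SoloBlindCorridorMap
import Summits.PneNP.PneNP.Theorems.SoloBlindEquivalentForms
import Literature.Computability.Complexity.PHCollapseNP
import Literature.Computability.Complexity.SparseHardSets
import Literature.Computability.Complexity.LadnerDiagonalizer
import Literature.Computability.Complexity.StructuralPHProofs
import HarnessLib

/-!
# Solo (blind) — equivalent forms of the summit, part 2: `PH`, `TAUT`, Mahaney, Ladner, Kannan

Corridor-map calibration for the accompanying document (`paper/sharpest-statement.md`, §0/§N).
Every statement below is assembled from PROVED tree theorems; the point is the typed list of
what the summit constant `PneNP` is literally equivalent to, resp. which unconditional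
disjunction it sits in.

* `SoloBlind.pneNP_iff_P_ne_PH : PneNP ↔ P ≠ PH`, `SoloBlind.pneNP_iff_SigmaP_ne_P (1 ≤ k) :
  PneNP ↔ Σₖᵖ ≠ P` (Stockmeyer's collapse, tree `PH_eq_NP_of_NP_eq_coNP`);
* `SoloBlind.pneNP_iff_TAUT_not_mem_P : PneNP ↔ TAUT ∉ P` (the `coNP` side; tree
  `CookLevin.isHard_coNP_TAUT_holds`, `TAUT_mem_coNP_holds`, `co_P_holds`);
* `SoloBlind.pneNP_iff_no_sparse_NP_hard` — MAHANEY: `PneNP` iff no `NP`-hard language (Karp) has a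
  polynomial census (tree `exists_isHard_sparse_iff`, a complete tree proof of Mahaney 1982), and
  the Ogiwara–Watanabe `P`-close form `SoloBlind.pneNP_iff_no_P_close_sparse_NP_hard`;
* `SoloBlind.pneNP_iff_exists_NP_intermediate` — LADNER: `PneNP` iff some `L ∈ NP ∖ P` is not
  `≤ᵀₚ`-hard for `NP` (tree `Ladner.ladner_holds'`, a complete tree proof of Ladner 1975);
* `SoloBlind.pneNP_or_P_not_subset_fixed_SIZE` — KANNAN's win-win as an UNCONDITIONAL disjunction:
  `PneNP ∨ ∀ k, ∃ L ∈ P, L ∉ SIZE(O(n^k))` (tree `kannan_holds` + `¬PneNP → PH = P`); equivalently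
  an UPPER bound implies the summit: `SoloBlind.pneNP_of_P_subset_fixed_SIZE`.

So a proof of the summit must, whether it wants to or not: separate `P` from every level `Σₖᵖ`,
`k ≥ 1`, and from `PH`; put `TAUT` outside `P`; rule out every sparse `NP`-hard set (even up to a
set in `P`); produce an `NP`-intermediate language; and it is the first disjunct of a theorem whose
second disjunct (fixed-polynomial circuit lower bounds for `P`) is also open.

No new mathematics. References: L. J. Stockmeyer, TCS 3 (1976) Thm. 3.2; S. R. Mahaney, JCSS 25
(1982); M. Ogiwara, O. Watanabe, SICOMP 20 (1991); R. E. Ladner, J. ACM 22 (1975) Thm. 1;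
R. Kannan, Inform. Control 55 (1982) Thm. 2; S. Arora, B. Barak (2009) Thms. 3.3, 5.4, 6.19–6.20.
-/

namespace Summit.PneNP.PneNP.Theorems

open Literature.Computability.Complexity
open scoped Literature.Computability.Complexity.Notation

/-! ### The polynomial hierarchy side -/

/-- Under the negated summit the hierarchy collapses to `P`: `¬PneNP` gives `P = NP`, hence
`NP = coNP` (`co P = P`) and `PH = NP = P`. [Stockmeyer 1976, Thm. 3.2; Arora–Barak 2009, Thm. 5.4] -/
theorem SoloBlind.PH_eq_P_of_not_pneNP (h : ¬ PneNP) : PH = Classes.P := by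
  have hPNP : Classes.P = Nondeterministic.NP := by
    by_contra hne
    exact h (SoloBlind.pneNP_iff_P_ne_NP.2 hne)
  have hco : Nondeterministic.NP = coNP := by
    change Nondeterministic.NP = co Nondeterministic.NP
    rw [← hPNP]
    exact co_P_holds.symm
  rw [PH_eq_NP_of_NP_eq_coNP hco, hPNP]

/-- **`PneNP ↔ P ≠ PH`.** (`→`: `NP ⊆ PH`; `←`: `P = NP` collapses `PH` to `P`.)
[Stockmeyer 1976, Thm. 3.2; Arora–Barak 2009, Thm. 5.4] -/
theorem SoloBlind.pneNP_iff_P_ne_PH : PneNP ↔ Classes.P ≠ PH := by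
  rw [SoloBlind.pneNP_iff_P_ne_NP]
  constructor
  · intro hne hPH
    apply hne
    apply Set.Subset.antisymm P_subset_NP_holds
    intro L hL
    rw [hPH]
    exact NP_subset_PH_holds hL
  · intro hne heq
    have hn : ¬ PneNP := fun hp => (SoloBlind.pneNP_iff_P_ne_NP.1 hp) heq
    exact hne (SoloBlind.PH_eq_P_of_not_pneNP hn).symm

/-- **`PneNP ↔ Σₖᵖ ≠ P` for every `k ≥ 1`.** (`→`: `NP = Σ₁ᵖ ⊆ Σₖᵖ`; `←`: under `P = NP`,
`Σₖᵖ ⊆ PH = P ⊆ Σₖᵖ`.) [Stockmeyer 1976, Thm. 3.2; Arora–Barak 2009, Thm. 5.4] -/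
theorem SoloBlind.pneNP_iff_SigmaP_ne_P {k : ℕ} (hk : 1 ≤ k) : PneNP ↔ SigmaP k ≠ Classes.P := by
  -- monotonicity `Σ₁ ⊆ Σₖ` by induction from `SigmaP_subset_succ_holds`
  have hmono : ∀ j, 1 ≤ j → SigmaP 1 ⊆ SigmaP j := by
    intro j hj
    induction j with
    | zero => exact absurd hj (by omega)
    | succ j ih =>
      rcases Nat.lt_or_ge j 1 with hj0 | hj1
      · have : j = 0 := by omega
        subst this; exact le_rfl
      · exact (ih hj1).trans (SigmaP_subset_succ_holds j)
  rw [SoloBlind.pneNP_iff_P_ne_NP]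
  constructor
  · intro hne hk'
    apply hne
    apply Set.Subset.antisymm P_subset_NP_holds
    intro L hL
    rw [← SigmaP_one_holds] at hL
    rw [← hk']
    exact hmono k hk hL
  · intro hne heq
    have hn : ¬ PneNP := fun hp => (SoloBlind.pneNP_iff_P_ne_NP.1 hp) heq
    apply hne
    apply Set.Subset.antisymm
    · rw [← SoloBlind.PH_eq_P_of_not_pneNP hn]
      exact SigmaP_subset_PH k
    · exact P_subset_SigmaP k

/-! ### The `coNP` side -/

/-- **`PneNP ↔ TAUT ∉ P`**: the summit is a super-polynomial lower bound for propositional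
TAUTOLOGY just as well (`TAUT` is `coNP`-complete and `P` is closed under complement).
[Cook 1971; Arora–Barak 2009, Def. 2.19–2.20, Thm. 2.10] -/
theorem SoloBlind.pneNP_iff_TAUT_not_mem_P : PneNP ↔ TAUT ∉ Classes.P := by
  rw [SoloBlind.pneNP_iff_not_NP_subset_P]
  constructor
  · intro hNP hT
    apply hNP
    intro L hL
    -- `Lᶜ ∈ coNP` reduces to `TAUT ∈ P`, so `Lᶜ ∈ P`, so `L ∈ P`
    have hLc : Lᶜ ∈ coNP := by
      change Lᶜᶜ ∈ Nondeterministic.NP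
      rw [compl_compl]; exact hL
    have hLcP : Lᶜ ∈ Classes.P :=
      mem_P_of_karpReducible_holds (CookLevin.isHard_coNP_TAUT_holds _ hLc) hT
    exact compl_mem_P_iff.1 hLcP
  · intro hT hNP
    apply hT
    have hTc : TAUTᶜ ∈ Nondeterministic.NP := TAUT_mem_coNP_holds
    exact compl_mem_P_iff.1 (hNP hTc)

/-! ### Sparse hard sets (Mahaney; Ogiwara–Watanabe) -/

/-- **`PneNP` iff no `NP`-hard set is sparse** (Mahaney 1982, as the tree equivalence
`exists_isHard_sparse_iff`; sparseness = a polynomial census). So any proof of the summit rules out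
a Karp reduction of `SAT` to every polynomially sparse set. [Mahaney 1982; Arora–Barak 2009, §6 notes] -/
theorem SoloBlind.pneNP_iff_no_sparse_NP_hard :
    PneNP ↔ ¬ ∃ T : Language Bool, IsHard Nondeterministic.NP T ∧ ∃ q : Polynomial ℕ, ∀ n,
      ∃ C : Finset (List Bool), C.card ≤ q.eval n ∧ ∀ u ∈ T, u.length ≤ n → u ∈ C := by
  rw [SoloBlind.pneNP_iff_not_NP_subset_P, exists_isHard_sparse_iff]

/-- **`PneNP` iff no `NP`-hard set is `P`-close to sparse** (Ogiwara–Watanabe 1991, tree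
`exists_isHard_sparse_symmDiff_iff`): even an `NP`-hard `T` differing from some `D ∈ P` on a
polynomially sparse set forces `P = NP`. [Ogiwara–Watanabe 1991] -/
theorem SoloBlind.pneNP_iff_no_P_close_sparse_NP_hard :
    PneNP ↔ ¬ ∃ T D : Language Bool, IsHard Nondeterministic.NP T ∧ D ∈ Classes.P ∧
      ∃ q : Polynomial ℕ, ∀ n, ∃ C : Finset (List Bool), C.card ≤ q.eval n ∧
        ∀ u, (u ∈ T ↔ u ∉ D) → u.length ≤ n → u ∈ C := by
  rw [SoloBlind.pneNP_iff_not_NP_subset_P, exists_isHard_sparse_symmDiff_iff]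

/-! ### `NP`-intermediate languages (Ladner) -/

/-- **`PneNP` iff an `NP`-intermediate language exists** (Ladner 1975, Thm. 1, as the tree theorem
`Ladner.ladner_holds'`): some `L ∈ NP ∖ P` to which not every `NP` language `≤ᵀₚ`-reduces. The
converse direction is the witness itself. [Ladner 1975, Thm. 1; Arora–Barak 2009, Thm. 3.3] -/
theorem SoloBlind.pneNP_iff_exists_NP_intermediate :
    PneNP ↔ ∃ L ∈ Nondeterministic.NP, L ∉ Classes.P ∧
      ¬ ∀ L' ∈ Nondeterministic.NP, PolyTimeTuringReducible L' L := by
  rw [SoloBlind.pneNP_iff_P_ne_NP]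
  constructor
  · intro hne
    exact Ladner.ladner_holds' hne
  · rintro ⟨L, hL, hLP, -⟩ heq
    exact hLP (heq ▸ hL)

/-! ### Kannan's win-win as an unconditional disjunction -/

/-- **`PneNP ∨ P ⊄ SIZE(O(n^k))` for every `k`** (unconditionally): if `P = NP` then `PH = P`
(`SoloBlind.PH_eq_P_of_not_pneNP`), so Kannan's language of `Σ₂ᵖ ∩ Π₂ᵖ` without `O(n^k)`-size circuits
(`kannan_holds`) lies in `P`. At least one of the two open lower bounds is true.
[Kannan 1982, Thm. 2; Arora–Barak 2009, Thm. 6.19 ff.] -/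
theorem SoloBlind.pneNP_or_P_not_subset_fixed_SIZE :
    PneNP ∨ ∀ k : ℕ, ∃ L ∈ Classes.P, L ∉ ⋃ c : ℕ, SIZE (fun n => c * n ^ k + c) := by
  by_cases h : PneNP
  · exact Or.inl h
  · refine Or.inr fun k => ?_
    obtain ⟨L, hL, hLs⟩ := kannan_holds k
    refine ⟨L, ?_, hLs⟩
    rw [← SoloBlind.PH_eq_P_of_not_pneNP h]
    exact SigmaP_subset_PH 2 hL.1

/-- **An upper bound that implies the summit**: if, for some fixed `k`, every language in `P` has
circuits of size `O(n^k)`, then `PneNP`. (Believed false; recorded as the contrapositive reading of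
Kannan's win-win.) [Kannan 1982, Thm. 2] -/
theorem SoloBlind.pneNP_of_P_subset_fixed_SIZE
    (h : ∃ k : ℕ, ∀ L ∈ Classes.P, L ∈ ⋃ c : ℕ, SIZE (fun n => c * n ^ k + c)) : PneNP := by
  rcases SoloBlind.pneNP_or_P_not_subset_fixed_SIZE with hP | hK
  · exact hP
  · obtain ⟨k, hk⟩ := h
    obtain ⟨L, hL, hLs⟩ := hK k
    exact absurd (hk L hL) hLs

end Summit.PneNP.PneNP.Theorems
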